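import Summits.QuantumFields.YangMills.Theorems.BalabanUVNodesN15SiteScalarLayerMasslessDerived
import Summits.QuantumFields.YangMills.Theorems.BalabanUVNodesN15BackgroundSiteOfLetters
import Summits.QuantumFields.YangMills.Theorems.BalabanUVNodesN15DefectKernelAdjoint
import HarnessLib

/-!
# Route «BalabanUVNodes», cluster K4 «SpineRates» — node N15 = NE2: THE SITE LAYER WITH THE BACKGROUND LIVE IN THE TwoGrid ENTRY CURRENCY, IX — THE SITE SOCKETS' THREE LETTERS
# AND `NE2PlusSite` FROM A SCALAR-SITE SPECIES' THREE DIAGONAL LETTERS ALONE: the `U ≡ 1` layer is the GENUINE massless scalar site propagator (parts VII∕VIII), its dressing is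
# dag-n15-c S4's `dressedOp`, the perturbed matrix is LITERALLY `Q′G′²Q′*` (part VII's dictionary) — every `U ≡ 1` hypothesis of parts IV∕V DISCHARGED

Cell `pub-ymgap`, WIDTH SEAT `pub-ymgap-dag-n15-w1` (generation 2; director-ym №197 ∕ HUMAN RULING D-0149; chair R455 (A) ∕ R461; plan g81 `W-SEAT-START-LIST.md` v8 §n15).  `bears_on:
R4∕N15 · K3⁷ SpineGivenEndpointR13SepCoPH (stmt-QuantumFields-20544)`.  Filed `--kind proof --supports stmt-QuantumFields-20544 --as helper` — COUNT-NEUTRAL.  THEOREMS ONLY (0 `def`,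
0 `sorry`).  Imports this seat's part VIII `…N15SiteScalarLayerMasslessDerived` (`kingScalarLayer_massless_letters`; parts VII, V, IV through it), dag-n15-c S4 `…N15BackgroundSiteOfLetters`
(`dressedOp`, `hasMaj_dressedOp`, `hasMaj_dressedOp_sub`, `hasMaj_idef_dressedOp`, `bgConst`) and dag-n15-a part 2 `…N15DefectKernelAdjoint` (`card_fibre_kingProj`) BY NAME; nothing in the
tree is modified.

WHY.  Part V (`siteLetters_of_dressedLetters` ∕ `ne2PlusSite_sSiteExOn_of_dressedLetters`) turned BLOCK LETTERS of a `U ≡ 1` scalar layer `G` and of its dressed twin `X(U)` into the three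
ENTRY letters `hP` of the site sockets (parts II∕IV) and into `NE2PlusSite` BY NAME — with BOTH layers hypothetical.  Parts VII∕VIII made the `U ≡ 1` layer a theorem for the genuine
massless scalar site propagator `G′ = kingGOp L a_S 0 k (L^k) M = (−Δ^η + a_kQ′*Q′)⁻¹` with its derived pieces `D_μ`; dag-n15-c S4 builds the dressed layer `X(U) = dressedOp G′ D (V̂(U)) =
pr_none (1 − ĜV̂)⁻¹Ĝ` ([B9] (3.64)–(3.65) on the pair space) and its three letters from `G′, D_μ` AND a first-order SPECIES `V̂(U)` with three DIAGONAL letters (`V̂(Ū), V̂′(U) ≤ diagK (Kα₀)`,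
`𝔇(V̂′(U), V̂(Ū)) ≤ diagK (Kα₀θ_k)`).  THIS FILE composes them: for ANY scalar-site species on the coarse and fine site lattices of the tori of record carrying those three letters under
`Reg335 c₃₅ α₀ U`, the (3.65) site perturbations `P = siteEntries (sitePert365 blockOf G′ (dressedOp G′ D V̂))` of the two runs have part II∕IV's three entry letters, hence
`NE2PlusSite` — the species letters being the ONLY remaining input (a lane family's scalar-site species, e.g. the covariant-Laplacian-type coefficients of dag-n15-c's carriers, is
one instantiation away).

CONTENTS ([folklore] bookkeeping + landed theorems BY NAME).
* §1 `bgConst_mono_a₀` (S4's output constant is monotone in the smallness), `card_fibre_underPtN_ne` (King's site pairing has uniform non-empty fibres — `card_fibre_kingProj`).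
* §1b ★ `qggqRe_add_siteEntries_sitePert365` ∕ `siteEx_sitePert365_eq` ∕ `…_kingGOp` — WHAT THE SOCKET INVERTS: by part VII's dictionary, `qggqRe + siteEntries (sitePert365 blockOf G′ X) =
  siteEntries (siteForm blockOf 0 0 X)`, so `siteEx = [Q X² Q*]⁻¹` — literally the inverse of the DRESSED site form (3.48) (averaging species dropped), not a perturbation of a model.
* §2 ★★★ **`siteLetters_of_speciesLetters`** — part V's `siteLetters_of_dressedLetters` with `Gc∕Gf := kingGOp L a_S 0 …` (parts VII∕VIII: letters `β, m₀` at `θ_k = (L^k)^{−γ∕2}`),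
  `Xco∕Xfo := dressedOp G′ D V̂` (S4: `B = 2β`, `ε = 2β²Kc_r`, `m = bgConst(β, c_r, m₀, K, a₁)`, rate `δ∕2`, threshold `a₁ ∧ (2βKc_r + 1)⁻¹` so that `β(Kα₀)c_r ≤ ½`): the three
  entry letters `hP` of the sockets from the SPECIES letters alone.
* §3 ★★★ **`ne2PlusSite_sSiteExOn_of_speciesLetters`** — part IV's socket ∘ §2: `NE2PlusSite d′ p c₃₅` for the dressed site kernels
  `(Q′G′²Q′*_{L^mL^k} + P_f(U))⁻¹ − (Q′G′²Q′*_{L^k} + P_c(Ū))⁻¹` on any family over the sized carriers, from the species letters alone.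

HONEST FRAMING.  Count-neutral, species-independent BRIDGE (kernel bookkeeping + parts IV∕V∕VII∕VIII ∕ S4 by name); the SPECIES is a HYPOTHESIS here (three diagonal letters); the
propagator, its dressing mechanism and the perturbed matrix `Q′G′²Q′*` are GENUINE ∕ MODEL-EXACT (`U ≡ 1` linear theory on the finite tori of record `M_μ = 2L^e`, King's running
couplings, m² = 0); the averaging species `F₂ = Q′(U′U) − Q′` of (3.65) is DROPPED here (part VI's words add it).  NOT [B9] Thm 3.2 at a general (3.35)-regular `U` (NE2⁺ NOT PRINTED
as an η-rate); Node 00's [B9] layers of record are residual — **N15 is NOT discharged** (typed 28∕28 · discharged 5∕27 of record unchanged); one finite four-torus programme at fixed `ε` —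
NOT ℝ⁴, NOT infinite volume, NOT OS, NOT a mass gap, NOT Clay; R4 closes the conditional finite-𝕋⁴ rung `BalabanLadder.UV` only.  Restate-immune (no Theses import).
-/

set_option autoImplicit false

noncomputable section

open scoped BigOperators Matrix
open Finset

namespace Summit.QuantumFields.YangMills.BalabanUVNodes.N15.SiteLayerBg

open Literature.MathematicalPhysics.QuantumFieldTheory.Balaban1983to89
open Literature.MathematicalPhysics.QuantumFieldTheory.Balaban1983to89.B11SectG (BlockNorm HasMaj RowSum)
open Literature.MathematicalPhysics.QuantumFieldTheory.Balaban1983to89.T4EtaRate (PairedInstance EtaPairing NE2PlusSite)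
open Literature.MathematicalPhysics.QuantumFieldTheory.Balaban1983to89.T4EtaRateDefect (idef)
open Literature.MathematicalPhysics.QuantumFieldTheory.Balaban1983to89.T4EtaRateCoeffDefect (pull diagK diagK_nonneg diagK_mono fibre)
open Literature.MathematicalPhysics.QuantumFieldTheory.Balaban1983to89.B5Prop11Plancherel (Tor fine)
open Literature.MathematicalPhysics.QuantumFieldTheory.Balaban1983to89.B4Sect5Torus (tdist)
open Literature.MathematicalPhysics.QuantumFieldTheory.Balaban1983to89.B4Sect5Proof (latticeConst latticeConst_nonneg)
open Literature.MathematicalPhysics.QuantumFieldTheory.Balaban1983to89.B5QGGQ145Bounds (Idx qggqRe)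
open Literature.MathematicalPhysics.QuantumFieldTheory.Balaban1983to89.B6UnitTorusCarrier (unitTorusGeo triangle254_unitTorusGeo rowSum_unitTorusGeo)
open Literature.MathematicalPhysics.QuantumFieldTheory.Balaban1983to89.B9SectDSup (inv_one_sub_le_two)
open Literature.MathematicalPhysics.QuantumFieldTheory.King1986 (aK aK_pos)
open Literature.MathematicalPhysics.QuantumFieldTheory.King1986.Torus (fineOp blockOf tdistT tdistT_nonneg)
open Summit.QuantumFields.YangMills.BalabanUVNodes.N15.VectorPiece (unitTorusGeoS unitTorusGeoS_dist)
open Summit.QuantumFields.YangMills.BalabanUVNodes.N15.OperatorReadout (opGeo)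
open Summit.QuantumFields.YangMills.BalabanUVNodes.N15.BackgroundLayer (blkPair liftPair bgConst bgConst_nonneg)
open Summit.QuantumFields.YangMills.BalabanUVNodes.N15.SiteLayer (siteForm dressedOp hasMaj_dressedOp hasMaj_dressedOp_sub hasMaj_idef_dressedOp)
open Summit.QuantumFields.YangMills.BalabanUVNodes.N15.DefectKernel (card_fibre_kingProj)
open Summit.QuantumFields.YangMills.BalabanUVNodes.N15KingModelRung.Curved (kingGOp kingDOp underPtN val_underPtN)

variable {d : ℕ} {L : ℕ}

/-! ## §1 Two bookkeeping facts -/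

section Book

/-- S4's output constant `bgConst(β, c_r, m₀, K, a₀) = 2·(m₀c_r + m₀c_r(Ka₀)(2β) + β(Ka₀)(2β)c_r)` is MONOTONE in the smallness `a₀` (non-negative letters). [folklore] -/
theorem bgConst_mono_a₀ {β cr m₀ K a₀ a₁ : ℝ} (hβ : 0 ≤ β) (hcr : 0 ≤ cr) (hm₀ : 0 ≤ m₀) (hK : 0 ≤ K) (h : a₀ ≤ a₁) :
    bgConst β cr m₀ K a₀ ≤ bgConst β cr m₀ K a₁ := by
  unfold bgConst
  have h1 : m₀ * cr * (K * a₀ * (β * 2)) ≤ m₀ * cr * (K * a₁ * (β * 2)) :=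
    mul_le_mul_of_nonneg_left (mul_le_mul_of_nonneg_right (mul_le_mul_of_nonneg_left h hK) (by positivity)) (by positivity)
  have h2 : β * (K * a₀) * (β * 2) * cr ≤ β * (K * a₁) * (β * 2) * cr :=
    mul_le_mul_of_nonneg_right (mul_le_mul_of_nonneg_right (mul_le_mul_of_nonneg_left (mul_le_mul_of_nonneg_left h hK) hβ) (by positivity)) hcr
  nlinarith

variable [NeZero L]

/-- King's site pairing `underPtN L k m M` (`x ↦ ⌊x∕L^m⌋`) has UNIFORM fibres of `(L^m)^{d+1} ≠ 0` fine sites (dag-n15-a part 2 `card_fibre_kingProj`). [cite: King1986, p.664 (pairing convention «x′ ∈ B^n(x)»)] -/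
theorem card_fibre_underPtN_ne (k m : ℕ) (M : Fin (d + 1) → ℕ) [∀ μ, NeZero (M μ)] :
    ∃ N : ℕ, N ≠ 0 ∧ ∀ x, (fibre (underPtN L k m M) x).card = N :=
  ⟨(L ^ m) ^ (d + 1), pow_ne_zero _ (pow_ne_zero _ (NeZero.ne L)), fun x => card_fibre_kingProj L k m M (underPtN L k m M) (val_underPtN L k m M) x⟩

end Book


/-! ## §1b ★ What the socket inverts when the `U ≡ 1` layer is the massless scalar site propagator: the DRESSED site form's own matrix `Q X² Q*` -/

section Inverts

variable (M : Fin (d + 1) → ℕ) [∀ μ, NeZero (M μ)] {Xc : Type} [Fintype Xc] [DecidableEq Xc]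

/-- `siteEntries` is additive. [folklore] -/
theorem siteEntries_add (T T' : (Tor M → ℝ) →ₗ[ℝ] (Tor M → ℝ)) : siteEntries M (T + T') = siteEntries M T + siteEntries M T' := by
  ext p q
  simp only [siteEntries_apply, Matrix.add_apply, LinearMap.add_apply, Pi.add_apply]

/-- ★ **WHAT THE SOCKET INVERTS.**  With part VII's dictionary (`qggqRe n a M = siteEntries (siteForm₀ blockOf G′)` for `G′ = A₀(a, n², 0)⁻¹`), the perturbed site matrix of parts II∕IV at the
(3.65) perturbation `P = siteEntries (sitePert365 blockOf G′ X)` IS the matrix of the DRESSED site form `siteForm blockOf 0 0 X = Q∘X∘X∘Q*` ([B9] Thm 3.2 (3.48)'s `Q′G′²(U)Q′*` with the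
averaging species dropped): `qggqRe n a M + P = siteEntries (siteForm blockOf 0 0 X)`. [cite: Balaban1985BackgroundPropagators, Thm 3.2 (3.48) p.398 + (3.65) p.403 (shape); Balaban1984PropagatorsI, (1.45) p.26] -/
theorem qggqRe_add_siteEntries_sitePert365 (n : ℕ) [NeZero n] {a : ℝ} (ha : 0 < a) (X : (Tor (fine n M) → ℝ) →ₗ[ℝ] (Tor (fine n M) → ℝ)) :
    qggqRe n a M + siteEntries M (sitePert365 M (blockOf n M) (Matrix.mulVecLin (fineOp n M a ((n : ℝ) ^ 2) 0)⁻¹) X) =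
      siteEntries M (siteForm (blockOf n M) 0 0 X) := by
  rw [← siteEntries_siteForm₀_fineOp_inv M n ha, ← siteEntries_add]
  congr 1
  unfold sitePert365
  abel

/-- … hence the socket kernel `siteEx n a M P = (qggqRe + P)⁻¹` is `(siteEntries (siteForm blockOf 0 0 X))⁻¹ = [Q X² Q*]⁻¹` — literally the inverse of the dressed site form.
[cite: Balaban1985BackgroundPropagators, Thm 3.2 (3.48) p.398 (the operator inverted)] -/
theorem siteEx_sitePert365_eq (n : ℕ) [NeZero n] {a : ℝ} (ha : 0 < a) (X : (Tor (fine n M) → ℝ) →ₗ[ℝ] (Tor (fine n M) → ℝ)) :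
    siteEx n a M (siteEntries M (sitePert365 M (blockOf n M) (Matrix.mulVecLin (fineOp n M a ((n : ℝ) ^ 2) 0)⁻¹) X)) = (siteEntries M (siteForm (blockOf n M) 0 0 X))⁻¹ := by
  unfold siteEx
  rw [qggqRe_add_siteEntries_sitePert365 M n ha X]

/-- … and for the runs of part IV's `sSiteExOn` (coupling `a_K`, `K ≥ 1`): `qggqRe N (aK a L K) M + siteEntries (sitePert365 blockOf (kingGOp L a 0 K N M) X) = siteEntries (siteForm blockOf 0 0 X)`.
[cite: Balaban1985BackgroundPropagators, Thm 3.2 (3.48) p.398 (shape); King1986, (2.15) p.653] -/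
theorem qggqRe_add_siteEntries_sitePert365_kingGOp (L : ℕ) (hL : 1 < L) {a : ℝ} (ha : 0 < a) {K : ℕ} (hK : 1 ≤ K) (N : ℕ) [NeZero N]
    (X : (Tor (fine N M) → ℝ) →ₗ[ℝ] (Tor (fine N M) → ℝ)) :
    qggqRe N (aK a L K) M + siteEntries M (sitePert365 M (blockOf N M) (kingGOp L a 0 K N M) X) = siteEntries M (siteForm (blockOf N M) 0 0 X) := by
  have hLr : (1 : ℝ) < (L : ℝ) := by exact_mod_cast hL
  rw [kingGOp]
  exact qggqRe_add_siteEntries_sitePert365 M N (aK_pos ha hLr hK) X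

end Inverts

/-! ## §2 ★★★ The sockets' three site letters from a species' three diagonal letters -/

section Letters

variable [NeZero L] {I : Type} (Mn : I → Fin (d + 1) → ℕ) [hMn0 : ∀ i μ, NeZero (Mn i μ)] (kk mm : I → ℕ) (Msz : I → ℝ) (Bc Bf : I → B9.Backgrounds)
  (avg : ∀ i, (Bf i).Cfg → (Bc i).Cfg)
  (Vc : ∀ i, (Bc i).Cfg → ((Tor (fine (L ^ kk i) (Mn i)) × Option (Fin (d + 1)) → ℝ) →ₗ[ℝ] (Tor (fine (L ^ kk i) (Mn i)) → ℝ)))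
  (Vf : ∀ i, (Bf i).Cfg → ((Tor (fine (L ^ mm i * L ^ kk i) (Mn i)) × Option (Fin (d + 1)) → ℝ) →ₗ[ℝ] (Tor (fine (L ^ mm i * L ^ kk i) (Mn i)) → ℝ)))

/-- ★★★ **THE THREE SITE LETTERS OF PARTS II∕IV FROM A SCALAR-SITE SPECIES' THREE DIAGONAL LETTERS ALONE.**  Data per index `i`: torus of record `M i = 2L^{m_T i}`, scales
`k i, m i ≥ 1`, size datum, background carriers `Bc i ∕ Bf i` with `avg i`, and a first-order SPECIES on the pair spaces of the coarse ∕ fine site lattices, `V̂c i V`, `V̂f i U`.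
HYPOTHESIS (`hV`): constants `K ≥ 0`, `a₁ > 0` with, for `0 < α₀ ≤ a₁` and `U` `(3.35)`-regular at level `c₃₅`: `V̂c i (avg U) ≤ diagK (Kα₀)` (coarse blocks `blockOf`), `V̂f i U ≤ diagK (Kα₀)`
(fine blocks `blockOf ∘ underPtN`), `𝔇(V̂f i U, V̂c i (avg U)) ≤ diagK (Kα₀·(L^{k i})^{−γ∕2})` through `(pull (liftPair π), pull π)`.  CONCLUSION: part V's `hP` — the three entry letters
of the site perturbations `Pf i U := siteEntries (sitePert365 (blockOf ∘ π) G′_f (dressedOp G′_f D′ (V̂f i U)))`, `Pc i V := siteEntries (sitePert365 blockOf G′_c (dressedOp G′_c D (V̂c i V)))`,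
with `G′_c = kingGOp L a_S 0 (k i) (L^{k i}) (M i)`, `G′_f = kingGOp L a_S 0 (k i + m i) (L^{m i}L^{k i}) (M i)`, `D_μ, D′_μ` the `kingDOp`s — the GENUINE massless scalar site propagators
(part VII: the perturbed matrix is then literally `Q′G′²Q′*`).  Proof: parts VII∕VIII's six `U ≡ 1` letters + S4's three dressing theorems ⟹ part V's `hL` with
`(β, 2β, 2β²Kc_r + 1, bgConst(…, a₁′), m₀, δ∕2, a₁′)`, then part V. [cite: Balaban1985BackgroundPropagators, (3.63)–(3.67) pp.402–403 (mechanism), Thm 3.2 (3.48) p.398; King1986, p.664 (pairing), Prop. 3.8 (3.71) p.664; Balaban1984PropagatorsI, (1.45) p.26] -/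
theorem siteLetters_of_speciesLetters (hLodd : Odd L) (hL2 : 2 ≤ L) {aS : ℝ} (haS : 0 < aS) (c35 : ℝ) {γ : ℝ} (hγ0 : 0 < γ) (hγ1 : γ < 1)
    {mT : I → ℕ} (hMnT : ∀ i μ, Mn i μ = 2 * L ^ mT i) (hk : ∀ i, 1 ≤ kk i) (hm : ∀ i, 1 ≤ mm i)
    (hV : ∃ K a₁ : ℝ, 0 ≤ K ∧ 0 < a₁ ∧ ∀ (i : I) (α₀ : ℝ), 0 < α₀ → α₀ ≤ a₁ → ∀ U : (Bf i).Cfg, (Bf i).Reg335 c35 α₀ U →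
      HasMaj (BlockNorm.ofBlocks (unitTorusGeoS L (kk i) (Mn i) (Msz i)) (blkPair (blockOf (L ^ kk i) (Mn i))))
        (BlockNorm.ofBlocks (unitTorusGeoS L (kk i) (Mn i) (Msz i)) (blockOf (L ^ kk i) (Mn i))) (Vc i (avg i U)) (diagK fun _ => K * α₀) ∧
      HasMaj (BlockNorm.ofBlocks (unitTorusGeoS L (kk i) (Mn i) (Msz i)) (blkPair (blockOf (L ^ kk i) (Mn i) ∘ underPtN L (kk i) (mm i) (Mn i))))
        (BlockNorm.ofBlocks (unitTorusGeoS L (kk i) (Mn i) (Msz i)) (blockOf (L ^ kk i) (Mn i) ∘ underPtN L (kk i) (mm i) (Mn i))) (Vf i U) (diagK fun _ => K * α₀) ∧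
      HasMaj (BlockNorm.ofBlocks (unitTorusGeoS L (kk i) (Mn i) (Msz i)) (blkPair (blockOf (L ^ kk i) (Mn i))))
        (BlockNorm.ofBlocks (unitTorusGeoS L (kk i) (Mn i) (Msz i)) (blockOf (L ^ kk i) (Mn i) ∘ underPtN L (kk i) (mm i) (Mn i)))
        (idef (pull (liftPair (underPtN L (kk i) (mm i) (Mn i)))) (pull (underPtN L (kk i) (mm i) (Mn i))) (Vf i U) (Vc i (avg i U)))
        (diagK fun _ => K * α₀ * ((L : ℝ) ^ kk i) ^ (-(γ / 2)))) :
    ∃ δP ζ τ a₁ : ℝ, 0 < δP ∧ 0 < ζ ∧ 0 < τ ∧ 0 < a₁ ∧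
      ∀ (i : I) (α₀ : ℝ), 0 < α₀ → α₀ ≤ a₁ → ∀ U : (Bf i).Cfg, (Bf i).Reg335 c35 α₀ U →
        (∀ p p' : Idx (Mn i), |siteEntries (Mn i) (sitePert365 (Mn i) (blockOf (L ^ kk i) (Mn i)) (kingGOp L aS 0 (kk i) (L ^ kk i) (Mn i))
            (dressedOp (kingGOp L aS 0 (kk i) (L ^ kk i) (Mn i)) (fun μ => kingDOp L aS 0 (kk i) (L ^ kk i) (Mn i) μ) (Vc i (avg i U)))) p p'|
            ≤ ζ * α₀ * Real.exp (-(δP * tdist (Mn i) p p'))) ∧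
        (∀ p p' : Idx (Mn i), |siteEntries (Mn i) (sitePert365 (Mn i) (blockOf (L ^ kk i) (Mn i) ∘ underPtN L (kk i) (mm i) (Mn i))
            (kingGOp L aS 0 (kk i + mm i) (L ^ mm i * L ^ kk i) (Mn i))
            (dressedOp (kingGOp L aS 0 (kk i + mm i) (L ^ mm i * L ^ kk i) (Mn i)) (fun μ => kingDOp L aS 0 (kk i + mm i) (L ^ mm i * L ^ kk i) (Mn i) μ) (Vf i U))) p p'|
            ≤ ζ * α₀ * Real.exp (-(δP * tdist (Mn i) p p'))) ∧
        (∀ p p' : Idx (Mn i), |siteEntries (Mn i) (sitePert365 (Mn i) (blockOf (L ^ kk i) (Mn i) ∘ underPtN L (kk i) (mm i) (Mn i))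
              (kingGOp L aS 0 (kk i + mm i) (L ^ mm i * L ^ kk i) (Mn i))
              (dressedOp (kingGOp L aS 0 (kk i + mm i) (L ^ mm i * L ^ kk i) (Mn i)) (fun μ => kingDOp L aS 0 (kk i + mm i) (L ^ mm i * L ^ kk i) (Mn i) μ) (Vf i U))) p p'
            - siteEntries (Mn i) (sitePert365 (Mn i) (blockOf (L ^ kk i) (Mn i)) (kingGOp L aS 0 (kk i) (L ^ kk i) (Mn i))
              (dressedOp (kingGOp L aS 0 (kk i) (L ^ kk i) (Mn i)) (fun μ => kingDOp L aS 0 (kk i) (L ^ kk i) (Mn i) μ) (Vc i (avg i U)))) p p'|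
            ≤ τ * ((L : ℝ) ^ kk i) ^ (-(γ / 2)) * Real.exp (-(δP * tdist (Mn i) p p'))) := by
  obtain ⟨β, δ, m₀, hβ, hδ, hm₀, HU⟩ := kingScalarLayer_massless_letters (d := d) L hLodd hL2 haS hγ0.le hγ1
  obtain ⟨K, a₁, hK, ha₁, HV⟩ := hV
  -- the Combes–Thomas row sum at `σ = δ∕2`, the threshold
  set cr : ℝ := latticeConst (d + 1) (δ / 2) with hcr_def
  have hcr : 0 ≤ cr := latticeConst_nonneg _ (by positivity)
  set a₁' : ℝ := min a₁ (1 / (2 * β * K * cr + 1)) with ha₁'_def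
  have hden : 0 < 2 * β * K * cr + 1 := by positivity
  have ha₁' : 0 < a₁' := lt_min ha₁ (by positivity)
  have ha₁'a₁ : a₁' ≤ a₁ := min_le_left _ _
  have hguard : β * (K * a₁') * cr ≤ 1 / 2 := by
    have h1 : a₁' ≤ 1 / (2 * β * K * cr + 1) := min_le_right _ _
    have h2 : β * K * cr * a₁' ≤ β * K * cr * (1 / (2 * β * K * cr + 1)) := mul_le_mul_of_nonneg_left h1 (by positivity)
    have h3 : β * K * cr * (1 / (2 * β * K * cr + 1)) ≤ 1 / 2 := by
      rw [mul_one_div, div_le_iff₀ hden]; nlinarith [mul_nonneg (mul_nonneg hβ.le hK) hcr]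
    nlinarith
  refine siteLetters_of_dressedLetters (L := L) Mn kk Msz (fun i => Tor (fine (L ^ kk i) (Mn i))) (fun i => Tor (fine (L ^ mm i * L ^ kk i) (Mn i)))
    (fun i => blockOf (L ^ kk i) (Mn i)) (fun i => underPtN L (kk i) (mm i) (Mn i)) Bc Bf avg
    (fun i => kingGOp L aS 0 (kk i) (L ^ kk i) (Mn i)) (fun i => kingGOp L aS 0 (kk i + mm i) (L ^ mm i * L ^ kk i) (Mn i))
    (fun i V => dressedOp (kingGOp L aS 0 (kk i) (L ^ kk i) (Mn i)) (fun μ => kingDOp L aS 0 (kk i) (L ^ kk i) (Mn i) μ) (Vc i V))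
    (fun i U => dressedOp (kingGOp L aS 0 (kk i + mm i) (L ^ mm i * L ^ kk i) (Mn i)) (fun μ => kingDOp L aS 0 (kk i + mm i) (L ^ mm i * L ^ kk i) (Mn i) μ) (Vf i U))
    c35 (γP := γ / 2) (fun i => card_fibre_underPtN_ne (L := L) (kk i) (mm i) (Mn i))
    ⟨β, 2 * β, 2 * β ^ 2 * K * cr + 1, bgConst β cr m₀ K a₁', m₀, δ / 2, a₁', hβ.le, by positivity, by positivity, bgConst_nonneg hβ.le hcr hm₀.le hK ha₁'.le, hm₀.le,
      half_pos hδ, ha₁', fun i => ?_⟩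
  obtain ⟨hG, hD, hG', hD', hDG, hDD⟩ := HU (kk i) (hk i) (mm i) (hm i) (mT i) (Mn i) (hMnT i) (Msz i)
  -- carrier facts
  have htri := triangle254_unitTorusGeo L (kk i) (Mn i)
  have hrow := rowSum_unitTorusGeo L (kk i) (Mn i) (half_pos hδ)
  have hd : ∀ a b : (unitTorusGeoS L (kk i) (Mn i) (Msz i)).Site, 0 ≤ (unitTorusGeoS L (kk i) (Mn i) (Msz i)).dist a b := fun a b => tdistT_nonneg (Mn i) a b
  have hθ : 0 ≤ ((L : ℝ) ^ kk i) ^ (-(γ / 2)) := Real.rpow_nonneg (pow_nonneg (Nat.cast_nonneg _) _) _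
  -- weakening the `U ≡ 1` letters from rate `δ` to `δ∕2`
  have wk : ∀ {C : ℝ}, 0 ≤ C → ∀ y y' : Tor (Mn i), C * Real.exp (-(δ * tdistT (Mn i) y y')) ≤ C * Real.exp (-(δ / 2 * (unitTorusGeoS L (kk i) (Mn i) (Msz i)).dist y y')) :=
    fun hC y y' => mul_le_mul_of_nonneg_left (Real.exp_le_exp.mpr (neg_le_neg (by
      rw [unitTorusGeoS_dist]; nlinarith [tdistT_nonneg (Mn i) y y', hδ]))) hC
  have wkd : ∀ y y' : Tor (Mn i), m₀ * ((L : ℝ) ^ kk i) ^ (-(γ / 2)) * Real.exp (-(δ * tdistT (Mn i) y y'))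
      ≤ m₀ * ((L : ℝ) ^ kk i) ^ (-(γ / 2)) * Real.exp (-(δ / 2 * (unitTorusGeoS L (kk i) (Mn i) (Msz i)).dist y y')) := wk (mul_nonneg hm₀.le hθ)
  refine ⟨hG.mono (wk hβ.le), hG'.mono (wk hβ.le), hDG.mono wkd, fun α₀ hα₀ hαa U hreg => ?_⟩
  obtain ⟨hVc, hVf, hDV⟩ := HV i α₀ hα₀ (hαa.trans ha₁'a₁) U hreg
  have hR : 0 ≤ K * α₀ := mul_nonneg hK hα₀.le
  have hq : β * (K * α₀) * cr ≤ 1 / 2 := (mul_le_mul_of_nonneg_right (mul_le_mul_of_nonneg_left (mul_le_mul_of_nonneg_left hαa hK) hβ.le) hcr).trans hguard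
  have hq1 : β * (K * α₀) * cr < 1 := by linarith
  have hinv : (1 - β * (K * α₀) * cr)⁻¹ ≤ 2 := inv_one_sub_le_two hq
  have hinv0 : 0 ≤ (1 - β * (K * α₀) * cr)⁻¹ := inv_nonneg.2 (by linarith)
  have hρδ : δ / 2 + δ / 2 ≤ δ := by linarith
  -- S4's three dressing theorems, coarse and fine, with the `U ≡ 1` letters at rate `δ` and `σ = ρ = δ∕2`
  have hXc := hasMaj_dressedOp (g := unitTorusGeoS L (kk i) (Mn i) (Msz i)) (blockOf (L ^ kk i) (Mn i)) htri hd hrow (by positivity) (by positivity : (0 : ℝ) ≤ δ / 2) hρδ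
    hβ.le hR hG hD hVc hq1
  have hXf := hasMaj_dressedOp (g := unitTorusGeoS L (kk i) (Mn i) (Msz i)) (blockOf (L ^ kk i) (Mn i) ∘ underPtN L (kk i) (mm i) (Mn i)) htri hd hrow (by positivity)
    (by positivity : (0 : ℝ) ≤ δ / 2) hρδ hβ.le hR hG' hD' hVf hq1
  have hEc := hasMaj_dressedOp_sub (g := unitTorusGeoS L (kk i) (Mn i) (Msz i)) (blockOf (L ^ kk i) (Mn i)) htri hd hrow (by positivity) (by positivity : (0 : ℝ) ≤ δ / 2) hρδ
    hβ.le hR hG hD hVc hq1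
  have hEf := hasMaj_dressedOp_sub (g := unitTorusGeoS L (kk i) (Mn i) (Msz i)) (blockOf (L ^ kk i) (Mn i) ∘ underPtN L (kk i) (mm i) (Mn i)) htri hd hrow (by positivity)
    (by positivity : (0 : ℝ) ≤ δ / 2) hρδ hβ.le hR hG' hD' hVf hq1
  have hDX := hasMaj_idef_dressedOp (g := unitTorusGeoS L (kk i) (Mn i) (Msz i)) (blockOf (L ^ kk i) (Mn i)) (underPtN L (kk i) (mm i) (Mn i)) htri hd hrow (by positivity) hcr
    (K := K) (a₀ := α₀) (by linarith : δ / 2 ≤ δ) hβ.le hm₀.le hθ hq hR le_rfl hG hD hG' hD' hDG hDD hVc hVf hDV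
  refine ⟨hXc.mono fun y y' => ?_, hXf.mono fun y y' => ?_, hEc.mono fun y y' => ?_, hEf.mono fun y y' => ?_, hDX.mono fun y y' => ?_⟩
  · exact mul_le_mul_of_nonneg_right (by nlinarith [mul_le_mul_of_nonneg_left hinv hβ.le]) (Real.exp_nonneg _)
  · exact mul_le_mul_of_nonneg_right (by nlinarith [mul_le_mul_of_nonneg_left hinv hβ.le]) (Real.exp_nonneg _)
  · refine mul_le_mul_of_nonneg_right ?_ (Real.exp_nonneg _)
    have h1 : β * (K * α₀ * (β * (1 - β * (K * α₀) * cr)⁻¹)) * cr = (β * β * K * cr * (1 - β * (K * α₀) * cr)⁻¹) * α₀ := by ring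
    rw [h1]
    refine mul_le_mul_of_nonneg_right ?_ hα₀.le
    nlinarith [mul_le_mul_of_nonneg_left hinv (show 0 ≤ β * β * K * cr by positivity)]
  · refine mul_le_mul_of_nonneg_right ?_ (Real.exp_nonneg _)
    have h1 : β * (K * α₀ * (β * (1 - β * (K * α₀) * cr)⁻¹)) * cr = (β * β * K * cr * (1 - β * (K * α₀) * cr)⁻¹) * α₀ := by ring
    rw [h1]
    refine mul_le_mul_of_nonneg_right ?_ hα₀.le
    nlinarith [mul_le_mul_of_nonneg_left hinv (show 0 ≤ β * β * K * cr by positivity)]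
  · have hsub : δ - δ / 2 = δ / 2 := by ring
    rw [hsub]
    exact mul_le_mul_of_nonneg_right (mul_le_mul_of_nonneg_right (bgConst_mono_a₀ hβ.le hcr hm₀.le hK hαa) hθ) (Real.exp_nonneg _)

end Letters

/-! ## §3 ★★★ `NE2PlusSite` over the sized carriers from the species letters alone -/

section Socket

variable [NeZero L] {I : Type} (Mn : I → Fin (d + 1) → ℕ) [hMn0 : ∀ i μ, NeZero (Mn i μ)] (kk mm : I → ℕ) (Msz : I → ℝ) (X : I → Type) [∀ i, Fintype (X i)]
  (blk : ∀ i, X i → Tor (Mn i)) (gf : I → B9.Geometry) (Bc Bf : I → B9.Backgrounds)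
  (Vc : ∀ i, (Bc i).Cfg → ((Tor (fine (L ^ kk i) (Mn i)) × Option (Fin (d + 1)) → ℝ) →ₗ[ℝ] (Tor (fine (L ^ kk i) (Mn i)) → ℝ)))
  (Vf : ∀ i, (Bf i).Cfg → ((Tor (fine (L ^ mm i * L ^ kk i) (Mn i)) × Option (Fin (d + 1)) → ℝ) →ₗ[ℝ] (Tor (fine (L ^ mm i * L ^ kk i) (Mn i)) → ℝ)))

/-- ★★★ **`NE2PlusSite` WITH THE BACKGROUND LIVE FROM A SCALAR-SITE SPECIES' THREE DIAGONAL LETTERS ALONE** — part IV's socket `ne2PlusSite_sSiteExOn_of_letters` fed by §2: on a family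
`pi i = ⟨opGeo (unitTorusGeoS L (k i) (M i) (M_sz i)) (X i) (blk i), gf i, Bc i, Bf i, pair i⟩` (tori of record `M i = 2L^{m_T i}`, `k i, m i ≥ 1`, guard scales `(gf i).M ≥ 1`), the η-difference
of the DRESSED site kernels `(Q′G′²Q′*_{L^mL^k, a_{k+m}} + P_f(U))⁻¹ − (Q′G′²Q′*_{L^k, a_k} + P_c(Ū))⁻¹`, `P = siteEntries (Q(X(X − G′) + (X − G′)G′)Q*)` with `G′` THE massless scalar site propagator
of the run and `X = dressedOp G′ D V̂` its S4-dressing by the species, satisfies `NE2PlusSite d′ p c₃₅` — the species' three letters being the ONLY input.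
[cite: Balaban1985BackgroundPropagators, Thm 3.2 (3.48) p.398 + Thm 3.14 pp.426–427 (quantifier template), (3.63)–(3.67) pp.402–403 (mechanism); Balaban1984PropagatorsI, (1.45) p.26; King1986, Prop. 3.8 (3.71) p.664, p.664 (pairing); CombesThomas1973, §II] -/
theorem ne2PlusSite_sSiteExOn_of_speciesLetters (hLodd : Odd L) (hL2 : 2 ≤ L) {aS : ℝ} (haS : 0 < aS) (c35 : ℝ) (d' : ℕ) (p : ℝ) {γ : ℝ} (hγ0 : 0 < γ) (hγ1 : γ < 1)
    {mT : I → ℕ} (hMnT : ∀ i μ, Mn i μ = 2 * L ^ mT i) (hk : ∀ i, 1 ≤ kk i) (hm : ∀ i, 1 ≤ mm i) (hM : ∀ i, 1 ≤ (gf i).M)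
    (pair : ∀ i, EtaPairing (opGeo (unitTorusGeoS L (kk i) (Mn i) (Msz i)) (X i) (blk i)) (gf i) (Bc i) (Bf i))
    (hV : ∃ K a₁ : ℝ, 0 ≤ K ∧ 0 < a₁ ∧ ∀ (i : I) (α₀ : ℝ), 0 < α₀ → α₀ ≤ a₁ → ∀ U : (Bf i).Cfg, (Bf i).Reg335 c35 α₀ U →
      HasMaj (BlockNorm.ofBlocks (unitTorusGeoS L (kk i) (Mn i) (Msz i)) (blkPair (blockOf (L ^ kk i) (Mn i))))
        (BlockNorm.ofBlocks (unitTorusGeoS L (kk i) (Mn i) (Msz i)) (blockOf (L ^ kk i) (Mn i))) (Vc i ((pair i).avg U)) (diagK fun _ => K * α₀) ∧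
      HasMaj (BlockNorm.ofBlocks (unitTorusGeoS L (kk i) (Mn i) (Msz i)) (blkPair (blockOf (L ^ kk i) (Mn i) ∘ underPtN L (kk i) (mm i) (Mn i))))
        (BlockNorm.ofBlocks (unitTorusGeoS L (kk i) (Mn i) (Msz i)) (blockOf (L ^ kk i) (Mn i) ∘ underPtN L (kk i) (mm i) (Mn i))) (Vf i U) (diagK fun _ => K * α₀) ∧
      HasMaj (BlockNorm.ofBlocks (unitTorusGeoS L (kk i) (Mn i) (Msz i)) (blkPair (blockOf (L ^ kk i) (Mn i))))
        (BlockNorm.ofBlocks (unitTorusGeoS L (kk i) (Mn i) (Msz i)) (blockOf (L ^ kk i) (Mn i) ∘ underPtN L (kk i) (mm i) (Mn i)))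
        (idef (pull (liftPair (underPtN L (kk i) (mm i) (Mn i)))) (pull (underPtN L (kk i) (mm i) (Mn i))) (Vf i U) (Vc i ((pair i).avg U)))
        (diagK fun _ => K * α₀ * ((L : ℝ) ^ kk i) ^ (-(γ / 2)))) :
    NE2PlusSite d' p c35 (fun i => (⟨opGeo (unitTorusGeoS L (kk i) (Mn i) (Msz i)) (X i) (blk i), gf i, Bc i, Bf i, pair i⟩ : PairedInstance))
      (sSiteExOn Mn kk mm Msz X blk gf Bc Bf aS pair
        (fun i U => siteEntries (Mn i) (sitePert365 (Mn i) (blockOf (L ^ kk i) (Mn i) ∘ underPtN L (kk i) (mm i) (Mn i))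
          (kingGOp L aS 0 (kk i + mm i) (L ^ mm i * L ^ kk i) (Mn i))
          (dressedOp (kingGOp L aS 0 (kk i + mm i) (L ^ mm i * L ^ kk i) (Mn i)) (fun μ => kingDOp L aS 0 (kk i + mm i) (L ^ mm i * L ^ kk i) (Mn i) μ) (Vf i U))))
        (fun i V => siteEntries (Mn i) (sitePert365 (Mn i) (blockOf (L ^ kk i) (Mn i)) (kingGOp L aS 0 (kk i) (L ^ kk i) (Mn i))
          (dressedOp (kingGOp L aS 0 (kk i) (L ^ kk i) (Mn i)) (fun μ => kingDOp L aS 0 (kk i) (L ^ kk i) (Mn i) μ) (Vc i V))))) :=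
  ne2PlusSite_sSiteExOn_of_letters Mn kk mm Msz X blk gf Bc Bf hLodd hL2 haS c35 d' p hMnT hk hM pair _ _ (half_pos hγ0)
    (siteLetters_of_speciesLetters (L := L) Mn kk mm Msz Bc Bf (fun i => (pair i).avg) Vc Vf hLodd hL2 haS c35 hγ0 hγ1 hMnT hk hm hV)

end Socket

end Summit.QuantumFields.YangMills.BalabanUVNodes.N15.SiteLayerBg

end
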